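import Summits.CriticalPhenomena.PercolationContinuityZ3.Theorems.PercNearOneGluingNoHeavyLowerTailSahiGridPatternCellCheck

/-!
# `NoHeavyLowerTail` (crux stmt-CriticalPhenomena-4575), Sahi programme P1: **SOUNDNESS OF THE CYLINDER-CERTIFICATE CHECKER**

Support file (Sahi cell, seat `prim-sahi-p1`, generation 11; `--supports stmt-CriticalPhenomena-4575`).  Pure proofs; no `sorry`, no
`native_decide`, standard axioms.  Continues `…SahiGridPatternCellCheck` (the executable checker `cylCheck` and its agreement lemmas).

**`cylGood_of_cylCheck`**: if `cylCheck v0 L cert = true` then for EVERY `n` and all up-sets `B, C ⊆ [3]^{n+3}`,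
`sStarD (cylSet (U v0)) B C ≥ 0` — the cylinder over the three-coordinate up-set `U v0` is a good first slot in every dimension.
PROOF: `L · sStarD = pairT (L·tgtT) + pairN (L·tgtN)` (cell form, `sStarD_cylSet_eq_pair`) `= Σ_{entries} c · (pairT atomT + pairN atomN)`
(the checked matrix identity + linearity, `pair_certT`) `≥ 0` atom by atom (`atom_nonneg`: Harris on fibres, PatternPos 3 on sections via
`sStarD_three_nonneg`, Kleitman around a cell, dual-cone generators on sections). [this work]
-/

namespace Summit.CriticalPhenomena.PercolationContinuityZ3.Theorems.SahiGridPattern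

open Finset SahiGrid3
open scoped BigOperators FinsetFamily

variable {n k : ℕ}

/-! ### Soundness -/

/-- Scaling a pairing. [this work] -/
theorem pairT_const_mul (c : ℤ) (M : Pd k → Pd k → ℤ) (B C : Finset (Pd (n + k))) :
    pairT (fun q r => c * M q r) B C = c * pairT M B C := by
  unfold pairT; rw [Finset.mul_sum]; refine Finset.sum_congr rfl fun q _ => ?_; rw [Finset.mul_sum]
  refine Finset.sum_congr rfl fun r _ => ?_; ring

/-- Scaling a pairing (`N`). [this work] -/
theorem pairN_const_mul (c : ℤ) (M : Pd k → Pd k → ℤ) (B C : Finset (Pd (n + k))) :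
    pairN (fun q r => c * M q r) B C = c * pairN M B C := by
  unfold pairN; rw [Finset.mul_sum]; refine Finset.sum_congr rfl fun q _ => ?_; rw [Finset.mul_sum]
  refine Finset.sum_congr rfl fun r _ => ?_; ring

/-- The pairings of a certificate are the certified combination of the atom pairings. [this work] -/
theorem pair_certT (v0 : List ℕ) (B C : Finset (Pd (n + 3))) :
    ∀ cert : List (ℕ × ℕ × List ℕ), pairT (certT v0 cert) B C + pairN (certN v0 cert) B C =
      (cert.map fun e => (e.1 : ℤ) * (pairT (atomT v0 e.2.1 e.2.2) B C + pairN (atomN v0 e.2.1 e.2.2) B C)).sum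
  | [] => by
    simp only [List.map_nil, List.sum_nil]
    have h1 : pairT (certT v0 []) B C = 0 := by unfold pairT certT; simp
    have h2 : pairN (certN v0 []) B C = 0 := by unfold pairN certN; simp
    rw [h1, h2]; simp
  | e :: t => by
    rw [List.map_cons, List.sum_cons, ← pair_certT v0 B C t]
    have h1 : pairT (certT v0 (e :: t)) B C = (e.1 : ℤ) * pairT (atomT v0 e.2.1 e.2.2) B C + pairT (certT v0 t) B C := by
      rw [← pairT_smul_add]; rfl
    have h2 : pairN (certN v0 (e :: t)) B C = (e.1 : ℤ) * pairN (atomN v0 e.2.1 e.2.2) B C + pairN (certN v0 t) B C := by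
      rw [← pairN_smul_add]; rfl
    rw [h1, h2]; ring

/-- Valid generator weights are nonnegative on the sections of an up-set. [this work] -/
theorem sectNonneg_gv {B : Finset (Pd (n + 3))} (hB : IsUpperSet (B : Set (Pd (n + 3)))) {lo hi : ℕ} (h : gvOK lo hi = true) :
    ∀ ξ : Pd n, 0 ≤ ∑ p : P3, gv lo hi p * ind B (glue ξ p) := by
  intro ξ
  have e : (∑ p : P3, gv lo hi p * ind B (glue ξ p)) = ∑ p ∈ sect B ξ, gv lo hi p := by
    rw [← Finset.sum_subset (Finset.subset_univ (sect B ξ)) (fun p _ hp => by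
          have : ind B (glue ξ p) = 0 := by unfold ind; rw [if_neg]; unfold sect at hp; simpa using hp
          rw [this]; ring)]
    refine Finset.sum_congr rfl fun p hp => ?_
    have : ind B (glue ξ p) = 1 := by unfold ind; rw [if_pos]; unfold sect at hp; simpa using hp
    rw [this]; ring
  rw [e]
  exact sum_gv_nonneg (isUpperSet_sect hB ξ) h

/-- The Harris atom in matrix form: `δ`-matrix on `T` minus `δ`-matrix on `N`. [this work] -/
theorem harrisAtom_nonneg {B C : Finset (Pd (n + 3))} (hB : IsUpperSet (B : Set (Pd (n + 3)))) (hC : IsUpperSet (C : Set (Pd (n + 3))))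
    (a b : ℕ) :
    0 ≤ pairT (fun q r : P3 => if pidx q = a ∧ pidx r = b then (1:ℤ) else 0) B C
      + pairN (fun q r : P3 => -(if pidx q = a ∧ pidx r = b then (1:ℤ) else 0)) B C := by
  unfold pairT pairN
  rw [← Finset.sum_add_distrib]
  refine Finset.sum_nonneg fun q _ => ?_
  rw [← Finset.sum_add_distrib]
  refine Finset.sum_nonneg fun r _ => ?_
  have h := cellN_le_cellT hB hC q r
  dsimp only
  split_ifs <;> nlinarith

/-- **Each atom is nonnegative** on up-sets. [this work] -/
theorem atom_nonneg {v0 : List ℕ} (hU : IsUpperSet ((U v0 : Finset P3) : Set P3)) {B C : Finset (Pd (n + 3))}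
    (hB : IsUpperSet (B : Set (Pd (n + 3)))) (hC : IsUpperSet (C : Set (Pd (n + 3)))) {kd : ℕ} {ps : List ℕ}
    (hok : entryOK (0, kd, ps) = true) :
    0 ≤ pairT (atomT v0 kd ps) B C + pairN (atomN v0 kd ps) B C := by
  unfold entryOK at hok
  unfold atomT atomN
  by_cases h0 : kd = 0
  · subst h0; simp only [if_true]
    exact harrisAtom_nonneg hB hC _ _
  simp only [if_neg h0]
  -- good-slot atoms
  have hV : (kd = 1 ∨ kd = 2) → ∀ X Y : Finset P3, IsUpperSet (X : Set P3) → IsUpperSet (Y : Set P3) → 0 ≤ sStarD (U ps) X Y := by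
    intro h12 X Y hX hY
    have hps : upOK ps = true := by simpa [h12] using hok
    exact sStarD_three_nonneg (U ps) X Y (isUpperSet_of_upOK hps) hX hY
  by_cases h1 : kd = 1
  · subst h1; simp only [if_true, show (1:ℕ) ≠ 2 by decide, if_false, show (1:ℕ) ≠ 4 by decide, show (1:ℕ) ≠ 6 by decide,
      show (1:ℕ) ≠ 8 by decide]
    rw [pairT_congr (fun q r => ppL_eq ps q r), pairN_zero, add_zero]
    exact pairT_sliceBeta_nonneg (hV (Or.inl rfl)) hB hC
  simp only [if_neg h1]
  by_cases h2 : kd = 2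
  · subst h2; simp only [if_true, show (2:ℕ) ≠ 3 by decide, if_false, show (2:ℕ) ≠ 5 by decide, show (2:ℕ) ≠ 7 by decide]
    rw [pairN_congr (fun q r => ppL_eq ps q r), pairT_zero, zero_add]
    exact pairN_sliceBeta_nonneg (hV (Or.inr rfl)) hB hC
  simp only [if_neg h2]
  have h12 : ¬(kd = 1 ∨ kd = 2) := fun h' => h'.elim h1 h2
  simp only [if_neg h12] at hok
  -- Kleitman atoms (kinds 3–6): generator validity from `hok`
  have hg : (kd = 3 ∨ kd = 4 ∨ kd = 5 ∨ kd = 6) → gvOK (ps.getD 1 0) (ps.getD 2 0) = true := by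
    intro h36; simpa [h36] using hok
  by_cases h3 : kd = 3
  · subst h3; simp only [if_true, show (3:ℕ) ≠ 4 by decide, if_false, show (3:ℕ) ≠ 6 by decide, show (3:ℕ) ≠ 8 by decide]
    rw [pairN_zero, add_zero]
    simp_rw [klC_eq]
    exact prodT_nonneg (sectNonneg_gv hB (hg (Or.inl rfl))) (sectNonneg_klCoef hU hC _)
  simp only [if_neg h3]
  by_cases h4 : kd = 4
  · subst h4; simp only [if_true, show (4:ℕ) ≠ 5 by decide, if_false, show (4:ℕ) ≠ 7 by decide]
    rw [pairT_zero, zero_add]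
    simp_rw [klC_eq]
    exact prodN_nonneg (sectNonneg_gv hB (hg (Or.inr (Or.inl rfl)))) (sectNonneg_klCoef hU hC _)
  simp only [if_neg h4]
  by_cases h5 : kd = 5
  · subst h5; simp only [if_true, show (5:ℕ) ≠ 6 by decide, if_false, show (5:ℕ) ≠ 8 by decide]
    rw [pairN_zero, add_zero]
    simp_rw [klC_eq]
    exact prodT_nonneg (sectNonneg_klCoef hU hB _) (sectNonneg_gv hC (hg (Or.inr (Or.inr (Or.inl rfl)))))
  simp only [if_neg h5]
  by_cases h6 : kd = 6
  · subst h6; simp only [if_true, show (6:ℕ) ≠ 7 by decide, if_false]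
    rw [pairT_zero, zero_add]
    simp_rw [klC_eq]
    exact prodN_nonneg (sectNonneg_klCoef hU hB _) (sectNonneg_gv hC (hg (Or.inr (Or.inr (Or.inr rfl)))))
  simp only [if_neg h6]
  have h36 : ¬(kd = 3 ∨ kd = 4 ∨ kd = 5 ∨ kd = 6) := fun h' => by rcases h' with h' | h' | h' | h' <;> contradiction
  simp only [if_neg h36] at hok
  have hg2 : (kd = 7 ∨ kd = 8) → gvOK (ps.getD 0 0) (ps.getD 1 0) = true ∧ gvOK (ps.getD 2 0) (ps.getD 3 0) = true := by
    intro h78; simpa [h78] using hok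
  by_cases h7 : kd = 7
  · subst h7; simp only [if_true, show (7:ℕ) ≠ 8 by decide, if_false]
    rw [pairN_zero, add_zero]
    exact prodT_nonneg (sectNonneg_gv hB (hg2 (Or.inl rfl)).1) (sectNonneg_gv hC (hg2 (Or.inl rfl)).2)
  simp only [if_neg h7]
  by_cases h8 : kd = 8
  · subst h8; simp only [if_true]
    rw [pairT_zero, zero_add]
    exact prodN_nonneg (sectNonneg_gv hB (hg2 (Or.inr rfl)).1) (sectNonneg_gv hC (hg2 (Or.inr rfl)).2)
  simp only [if_neg h8]
  rw [pairT_zero, pairN_zero]; norm_num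

/-- **SOUNDNESS OF THE CYLINDER CHECKER** (every `n`): a passing certificate proves that the cylinder over `U v0 ⊆ [3]^3` is a good first
slot of `[3]^{n+3}`: `sStarD (cylSet (U v0)) B C ≥ 0` for all up-sets `B, C`. [this work] -/
theorem cylGood_of_cylCheck {v0 : List ℕ} {L : ℕ} {cert : List (ℕ × ℕ × List ℕ)} (h : cylCheck v0 L cert = true) :
    ∀ (n : ℕ) (B C : Finset (Pd (n + 3))), IsUpperSet (B : Set (Pd (n + 3))) → IsUpperSet (C : Set (Pd (n + 3))) →
      0 ≤ sStarD (cylSet (U v0) : Finset (Pd (n + 3))) B C := by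
  obtain ⟨hL, hup, hent, hid⟩ := cylCheck_spec h
  have hU := isUpperSet_of_upOK hup
  intro n B C hB hC
  have key : (L : ℤ) * sStarD (cylSet (U v0) : Finset (Pd (n + 3))) B C =
      (cert.map fun e => (e.1 : ℤ) * (pairT (atomT v0 e.2.1 e.2.2) B C + pairN (atomN v0 e.2.1 e.2.2) B C)).sum := by
    rw [sStarD_cylSet_eq_pair, mul_add, ← pairT_const_mul, ← pairN_const_mul,
      pairT_congr (fun q r => (hid q r).1), pairN_congr (fun q r => (hid q r).2), pair_certT]
  have hnn : 0 ≤ (cert.map fun e => (e.1 : ℤ) * (pairT (atomT v0 e.2.1 e.2.2) B C + pairN (atomN v0 e.2.1 e.2.2) B C)).sum := by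
    refine List.sum_nonneg ?_
    intro x hx
    rw [List.mem_map] at hx
    obtain ⟨e, he, rfl⟩ := hx
    have hok : entryOK (0, e.2.1, e.2.2) = true := by
      have := hent e he; unfold entryOK at this ⊢; exact this
    exact mul_nonneg (by positivity) (atom_nonneg hU hB hC hok)
  rw [← key] at hnn
  exact nonneg_of_mul_nonneg_right (by rwa [mul_comm] at hnn) (by exact_mod_cast hL)

end Summit.CriticalPhenomena.PercolationContinuityZ3.Theorems.SahiGridPattern
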